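import Summits.CriticalPhenomena.CardyFormulaZ2.Theorems.CardyComplexConeEdgePrecompactUFRSOneStrandGenuine
import Literature.Probability.Percolation.FourArmGarbanSquareDomain

/-!
# The lattice box of an axis-parallel rectangle and its discrete boundary
(line `qkz-strip-boundary-arm` of crux `CardyComplexCone.EdgePrecompact`, stmt-CriticalPhenomena-11387;
Part A of the geometric input of the registered one-strand decay `ufrs_rect_oneStrandDecay` (ONE);
registered anchor `ufrs_rect_sideOfZdBoundary`; Part B `…EdgePrecompactUFRSRectMono.lean` proves
that the discrete boundary is monochromatic away from the marked edges)

For `ℤ²`-admissible Dobrushin data `E` of the open rectangle `(x₀, x₁) × (y₀, y₁)`: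

* `preconnected_meshVertexGraph_rect`, `meshDomain_rect`, `discreteDomainGraph_adj_rect` — the mesh
  graph of the rectangle is connected (column and row moves inside the lattice box), so the
  discrete domain is the whole lattice box `V = meshVertices` and `Ω_δ` is the nearest-neighbour
  graph on it;
* `exists_adj_not_mem_of_mem_zdBoundary`, `mem_zdBoundary_of_adj_not_mem` — hence the
  square-lattice discrete boundary `E.zdBoundary` (vertex boundary and endpoints of face-boundary
  edges) is exactly the set of box sites with a lattice neighbour outside the box;
* `side_of_mem_zdBoundary` (closed form: `ufrs_rect_sideOfZdBoundary`), `mem_zdBoundary_of_side` —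
  equivalently, the box sites on the bottom or top row or on the left or right column of the box.

References: S. Smirnov, C. R. Acad. Sci. Paris 333 (2001), §2 (discrete domain, arcs, marked
edges); D. Chelkak, S. Smirnov, Invent. Math. 189 (2012), §1.2 (discretisation conventions).
-/

set_option linter.unusedVariables false

namespace Summit.CriticalPhenomena.CardyFormulaZ2.Cruxes.EdgePrecompact.QkzStripBoundaryArm

open MeasureTheory Filter Set Metric
open scoped Topology BigOperators Pointwise
open Literature.Probability.LatticeModels Literature.Probability.Percolation
open Literature.Probability.RandomPlanarGeometry (DobrushinDomain)
open Summit.CriticalPhenomena.CardyFormulaZ2.Theses.CardyComplexCone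

noncomputable section

/-! ## The lattice box of an open axis-parallel rectangle -/

section Rect

variable {x₀ x₁ y₀ y₁ δ : ℝ}

/-- Mesh vertices of the rectangle, in coordinates. -/
theorem mem_meshVertices_rect {v : Site 2} :
    v ∈ meshVertices (Set.Ioo x₀ x₁ ×ℂ Set.Ioo y₀ y₁) δ ↔
      (x₀ < δ * v 0 ∧ δ * v 0 < x₁) ∧ (y₀ < δ * v 1 ∧ δ * v 1 < y₁) := by
  rw [mem_meshVertices_iff, Complex.mem_reProdIm, meshPoint_re, meshPoint_im, Set.mem_Ioo, Set.mem_Ioo]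

/-- The open rectangle is convex. -/
theorem convex_rect : Convex ℝ (Set.Ioo x₀ x₁ ×ℂ Set.Ioo y₀ y₁) :=
  ((convex_Ioo _ _).linear_preimage Complex.reLm).inter ((convex_Ioo _ _).linear_preimage Complex.imLm)

/-- Lattice neighbours inside the rectangle are mesh-adjacent (convexity). -/
theorem meshGraph_adj_rect {x y : Site 2} (hx : x ∈ meshVertices (Set.Ioo x₀ x₁ ×ℂ Set.Ioo y₀ y₁) δ)
    (hy : y ∈ meshVertices (Set.Ioo x₀ x₁ ×ℂ Set.Ioo y₀ y₁) δ) (hxy : (zdGraph 2).Adj x y) :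
    (meshGraph (Set.Ioo x₀ x₁ ×ℂ Set.Ioo y₀ y₁) δ).Adj x y :=
  meshGraph_adj_iff.2 ⟨hxy, (convex_rect.segment_subset hx hy).trans subset_closure⟩

/-- The right and the upper lattice neighbours of a site given in coordinates. -/
theorem adj_right_or_up (i j a b : ℤ) (h : (a = i + 1 ∧ b = j) ∨ (a = i ∧ b = j + 1)) :
    (zdGraph 2).Adj (![i, j] : Site 2) ![a, b] := by
  rw [zdGraph_adj_iff]
  rcases h with ⟨rfl, rfl⟩ | ⟨rfl, rfl⟩
  · refine ⟨0, Or.inl ?_⟩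
    ext k; fin_cases k <;> simp
  · refine ⟨1, Or.inl ?_⟩
    ext k; fin_cases k <;> simp

/-- **The mesh graph of the rectangle is connected**: two mesh vertices are joined by a column move
followed by a row move inside the lattice box. -/
theorem preconnected_meshVertexGraph_rect (hδ : 0 < δ) :
    (meshVertexGraph (Set.Ioo x₀ x₁ ×ℂ Set.Ioo y₀ y₁) δ).Preconnected := by
  set V := meshVertices (Set.Ioo x₀ x₁ ×ℂ Set.Ioo y₀ y₁) δ with hV
  set G := meshVertexGraph (Set.Ioo x₀ x₁ ×ℂ Set.Ioo y₀ y₁) δ with hG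
  have memV : ∀ i j : ℤ, (![i, j] : Site 2) ∈ V ↔
      (x₀ < δ * i ∧ δ * i < x₁) ∧ (y₀ < δ * j ∧ δ * j < y₁) := fun i j => by
    rw [hV, mem_meshVertices_rect]; simp
  have adjG : ∀ {a b : Site 2} (ha : a ∈ V) (hb : b ∈ V), (zdGraph 2).Adj a b →
      G.Adj ⟨a, ha⟩ ⟨b, hb⟩ := by
    intro a b ha hb hab
    simp only [hG, SimpleGraph.comap_adj, Function.Embedding.coe_subtype]
    exact meshGraph_adj_rect ha hb hab
  -- column moves
  have hcol : ∀ (i j : ℤ) (m : ℕ) (h0 : (![i, j] : Site 2) ∈ V) (h1 : (![i, j + m] : Site 2) ∈ V),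
      G.Reachable ⟨![i, j], h0⟩ ⟨![i, j + m], h1⟩ := by
    intro i j m
    induction m with
    | zero =>
      intro h0 h1
      have e : (⟨![i, j + ((0 : ℕ) : ℤ)], h1⟩ : V) = ⟨![i, j], h0⟩ := Subtype.ext (by simp)
      rw [e]
    | succ m ih =>
      intro h0 h1
      have h0' := (memV _ _).1 h0
      have h1' := (memV _ _).1 h1
      simp only [Int.cast_add, Int.cast_natCast, Nat.cast_succ, Int.cast_one] at h1'
      have hmid : (![i, j + m] : Site 2) ∈ V := by
        rw [memV]
        simp only [Int.cast_add, Int.cast_natCast]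
        have hm : (0 : ℝ) ≤ m := Nat.cast_nonneg m
        have e1 : δ * ((j : ℝ) + m) = δ * j + δ * m := by ring
        have e2 : δ * ((j : ℝ) + (m + 1)) = δ * j + δ * m + δ := by ring
        have h3 : 0 ≤ δ * (m : ℝ) := by positivity
        refine ⟨h0'.1, ?_, ?_⟩
        · linarith [h0'.2.1]
        · linarith [h1'.2.2]
      refine (ih h0 hmid).trans (SimpleGraph.Adj.reachable (adjG hmid h1 ?_))
      have := adj_right_or_up i (j + m) _ _ (Or.inr ⟨rfl, rfl⟩)
      push_cast
      rwa [← add_assoc]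
  have hcol' : ∀ (i j j' : ℤ) (h0 : (![i, j] : Site 2) ∈ V) (h1 : (![i, j'] : Site 2) ∈ V),
      G.Reachable ⟨![i, j], h0⟩ ⟨![i, j'], h1⟩ := by
    intro i j j' h0 h1
    rcases le_total j j' with h | h
    · obtain ⟨m, rfl⟩ : ∃ m : ℕ, j' = j + m := ⟨(j' - j).toNat, by omega⟩
      exact hcol i j m h0 h1
    · obtain ⟨m, rfl⟩ : ∃ m : ℕ, j = j' + m := ⟨(j - j').toNat, by omega⟩
      exact (hcol i j' m h1 h0).symm
  -- row moves
  have hrow : ∀ (i j : ℤ) (m : ℕ) (h0 : (![i, j] : Site 2) ∈ V) (h1 : (![i + m, j] : Site 2) ∈ V),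
      G.Reachable ⟨![i, j], h0⟩ ⟨![i + m, j], h1⟩ := by
    intro i j m
    induction m with
    | zero =>
      intro h0 h1
      have e : (⟨![i + ((0 : ℕ) : ℤ), j], h1⟩ : V) = ⟨![i, j], h0⟩ := Subtype.ext (by simp)
      rw [e]
    | succ m ih =>
      intro h0 h1
      have h0' := (memV _ _).1 h0
      have h1' := (memV _ _).1 h1
      simp only [Int.cast_add, Int.cast_natCast, Nat.cast_succ, Int.cast_one] at h1'
      have hmid : (![i + m, j] : Site 2) ∈ V := by
        rw [memV]
        simp only [Int.cast_add, Int.cast_natCast]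
        have hm : (0 : ℝ) ≤ m := Nat.cast_nonneg m
        have e1 : δ * ((i : ℝ) + m) = δ * i + δ * m := by ring
        have e2 : δ * ((i : ℝ) + (m + 1)) = δ * i + δ * m + δ := by ring
        have h3 : 0 ≤ δ * (m : ℝ) := by positivity
        refine ⟨⟨?_, ?_⟩, h0'.2⟩
        · linarith [h0'.1.1]
        · linarith [h1'.1.2]
      refine (ih h0 hmid).trans (SimpleGraph.Adj.reachable (adjG hmid h1 ?_))
      have := adj_right_or_up (i + m) j _ _ (Or.inl ⟨rfl, rfl⟩)
      push_cast
      rwa [← add_assoc]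
  have hrow' : ∀ (i i' j : ℤ) (h0 : (![i, j] : Site 2) ∈ V) (h1 : (![i', j] : Site 2) ∈ V),
      G.Reachable ⟨![i, j], h0⟩ ⟨![i', j], h1⟩ := by
    intro i i' j h0 h1
    rcases le_total i i' with h | h
    · obtain ⟨m, rfl⟩ : ∃ m : ℕ, i' = i + m := ⟨(i' - i).toNat, by omega⟩
      exact hrow i j m h0 h1
    · obtain ⟨m, rfl⟩ : ∃ m : ℕ, i = i' + m := ⟨(i - i').toNat, by omega⟩
      exact (hrow i' j m h1 h0).symm
  rintro ⟨u, hu⟩ ⟨v, hv⟩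
  have eu : (![u 0, u 1] : Site 2) = u := by ext k; fin_cases k <;> rfl
  have ev : (![v 0, v 1] : Site 2) = v := by ext k; fin_cases k <;> rfl
  have hu0 : (![u 0, u 1] : Site 2) ∈ V := by rwa [eu]
  have hv0 : (![v 0, v 1] : Site 2) ∈ V := by rwa [ev]
  have hu' := (memV _ _).1 hu0
  have hv' := (memV _ _).1 hv0
  have hw : (![u 0, v 1] : Site 2) ∈ V := (memV _ _).2 ⟨hu'.1, hv'.2⟩
  have e1 : (⟨![u 0, u 1], hu0⟩ : V) = ⟨u, hu⟩ := Subtype.ext eu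
  have e2 : (⟨![v 0, v 1], hv0⟩ : V) = ⟨v, hv⟩ := Subtype.ext ev
  have h := (hcol' (u 0) (u 1) (v 1) hu0 hw).trans (hrow' (u 0) (v 0) (v 1) hw hv0)
  rwa [e1, e2] at h

/-- **The discrete rectangle is the whole lattice box**: `meshDomain = meshVertices`. -/
theorem meshDomain_rect (hδ : 0 < δ) :
    meshDomain (Set.Ioo x₀ x₁ ×ℂ Set.Ioo y₀ y₁) δ = meshVertices (Set.Ioo x₀ x₁ ×ℂ Set.Ioo y₀ y₁) δ :=
  Literature.Probability.Percolation.meshDomain_eq_meshVertices_of_preconnected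
    (preconnected_meshVertexGraph_rect hδ)

/-- Adjacency in `Ω_δ` for the rectangle is lattice adjacency between box sites. -/
theorem discreteDomainGraph_adj_rect (hδ : 0 < δ) {x y : Site 2} :
    (discreteDomainGraph (Set.Ioo x₀ x₁ ×ℂ Set.Ioo y₀ y₁) δ).Adj x y ↔
      (zdGraph 2).Adj x y ∧ x ∈ meshVertices (Set.Ioo x₀ x₁ ×ℂ Set.Ioo y₀ y₁) δ ∧
        y ∈ meshVertices (Set.Ioo x₀ x₁ ×ℂ Set.Ioo y₀ y₁) δ := by
  rw [discreteDomainGraph_adj_iff, meshDomain_rect hδ]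
  constructor
  · rintro ⟨h, hx, hy⟩; exact ⟨(meshGraph_adj_iff.1 h).1, hx, hy⟩
  · rintro ⟨h, hx, hy⟩; exact ⟨meshGraph_adj_rect hx hy h, hx, hy⟩

end Rect

/-! ## The discrete boundary of admissible data on the rectangle -/

section Boundary

variable {x₀ x₁ y₀ y₁ : ℝ} {E : DiscreteDobrushin}

/-- Mesh vertices of the datum, in coordinates. -/
theorem mem_meshVertices_rect' (hEΩ : E.Ω = Set.Ioo x₀ x₁ ×ℂ Set.Ioo y₀ y₁) {v : Site 2} :
    v ∈ meshVertices E.Ω E.δ ↔ (x₀ < E.δ * v 0 ∧ E.δ * v 0 < x₁) ∧ (y₀ < E.δ * v 1 ∧ E.δ * v 1 < y₁) := by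
  rw [hEΩ]; exact mem_meshVertices_rect

/-- The discrete domain of the datum is the whole lattice box. -/
theorem meshDomain_eq_rect (hE : E.IsZdAdmissible) (hEΩ : E.Ω = Set.Ioo x₀ x₁ ×ℂ Set.Ioo y₀ y₁) :
    meshDomain E.Ω E.δ = meshVertices E.Ω E.δ := by
  rw [hEΩ]; exact meshDomain_rect hE.delta_pos

/-- `Ω_δ`-adjacency of the datum is lattice adjacency between box sites. -/
theorem dom_adj_iff_rect (hE : E.IsZdAdmissible) (hEΩ : E.Ω = Set.Ioo x₀ x₁ ×ℂ Set.Ioo y₀ y₁) {x y : Site 2} :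
    (discreteDomainGraph E.Ω E.δ).Adj x y ↔
      (zdGraph 2).Adj x y ∧ x ∈ meshVertices E.Ω E.δ ∧ y ∈ meshVertices E.Ω E.δ := by
  rw [hEΩ]; exact discreteDomainGraph_adj_rect hE.delta_pos

/-- The lattice neighbour of `x` obtained by increasing the coordinate `i`. -/
theorem adj_update_add_one (x : Site 2) (i : Fin 2) : (zdGraph 2).Adj x (Function.update x i (x i + 1)) := by
  rw [zdGraph_adj_iff]
  refine ⟨i, Or.inl ?_⟩
  ext k
  by_cases hk : k = i
  · subst hk; simp
  · simp [Function.update_of_ne hk, Pi.single_eq_of_ne hk]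

/-- The lattice neighbour of `x` obtained by decreasing the coordinate `i`. -/
theorem adj_update_sub_one (x : Site 2) (i : Fin 2) : (zdGraph 2).Adj x (Function.update x i (x i - 1)) := by
  rw [zdGraph_adj_iff]
  refine ⟨i, Or.inr ?_⟩
  ext k
  by_cases hk : k = i
  · subst hk; simp
  · simp [Function.update_of_ne hk, Pi.single_eq_of_ne hk]

/-- **A discrete boundary site of the rectangle has a lattice neighbour outside the box** (and lies
in the box): for the vertex boundary this is `Ω_δ = ` nearest-neighbour graph on the box; an
endpoint of a face-boundary edge is a corner of a non-inner face, which has a corner outside the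
box, one coordinate of which fails the box condition — moving that coordinate of the endpoint to
it gives the outside neighbour. -/
theorem exists_adj_not_mem_of_mem_zdBoundary (hE : E.IsZdAdmissible)
    (hEΩ : E.Ω = Set.Ioo x₀ x₁ ×ℂ Set.Ioo y₀ y₁) {x : Site 2} (hx : x ∈ E.zdBoundary) :
    x ∈ meshVertices E.Ω E.δ ∧ ∃ y, (zdGraph 2).Adj x y ∧ y ∉ meshVertices E.Ω E.δ := by
  have hadj : ∀ a b : Site 2, (discreteDomainGraph E.Ω E.δ).Adj a b ↔
      (zdGraph 2).Adj a b ∧ a ∈ meshVertices E.Ω E.δ ∧ b ∈ meshVertices E.Ω E.δ :=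
    fun a b => dom_adj_iff_rect hE hEΩ
  rcases (E.mem_zdBoundary_iff).1 hx with hmb | ⟨y, hfb⟩
  · obtain ⟨hxD, y, hxy, hn⟩ := mem_meshBoundary_iff.1 hmb
    have hxV := meshDomain_subset_meshVertices _ _ hxD
    exact ⟨hxV, y, hxy, fun hyV => hn ((hadj x y).2 ⟨hxy, hxV, hyV⟩)⟩
  · obtain ⟨hdom, -, g, hg, hxg, hyg⟩ := hfb
    have hxV : x ∈ meshVertices E.Ω E.δ := ((hadj _ _).1 hdom).2.1
    refine ⟨hxV, ?_⟩
    obtain ⟨c, hc, hcV⟩ : ∃ c, IsCorner c g ∧ c ∉ meshVertices E.Ω E.δ := by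
      by_contra hall
      push Not at hall
      exact hg fun v w hv hw hvw => (hadj v w).2 ⟨hvw, hall v hv, hall w hw⟩
    rw [mem_meshVertices_rect' hEΩ] at hcV
    have hxV' := (mem_meshVertices_rect' hEΩ).1 hxV
    have hc0 : c 0 = x 0 ∨ c 0 = x 0 + 1 ∨ c 0 = x 0 - 1 := by
      rcases hxg 0 with h | h <;> rcases hc 0 with h' | h' <;> omega
    have hc1 : c 1 = x 1 ∨ c 1 = x 1 + 1 ∨ c 1 = x 1 - 1 := by
      rcases hxg 1 with h | h <;> rcases hc 1 with h' | h' <;> omega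
    rcases not_and_or.1 hcV with h0 | h1
    · rcases hc0 with e | e | e
      · rw [e] at h0; exact absurd hxV'.1 h0
      · refine ⟨Function.update x 0 (x 0 + 1), adj_update_add_one x 0, fun hy => h0 ?_⟩
        have hy' := ((mem_meshVertices_rect' hEΩ).1 hy).1
        simp only [Function.update_self] at hy'
        rw [e]; exact hy'
      · refine ⟨Function.update x 0 (x 0 - 1), adj_update_sub_one x 0, fun hy => h0 ?_⟩
        have hy' := ((mem_meshVertices_rect' hEΩ).1 hy).1
        simp only [Function.update_self] at hy'
        rw [e]; exact hy'
    · rcases hc1 with e | e | e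
      · rw [e] at h1; exact absurd hxV'.2 h1
      · refine ⟨Function.update x 1 (x 1 + 1), adj_update_add_one x 1, fun hy => h1 ?_⟩
        have hy' := ((mem_meshVertices_rect' hEΩ).1 hy).2
        simp only [Function.update_self] at hy'
        rw [e]; exact hy'
      · refine ⟨Function.update x 1 (x 1 - 1), adj_update_sub_one x 1, fun hy => h1 ?_⟩
        have hy' := ((mem_meshVertices_rect' hEΩ).1 hy).2
        simp only [Function.update_self] at hy'
        rw [e]; exact hy'

/-- Conversely, a box site with a lattice neighbour outside the box is a discrete boundary site. -/
theorem mem_zdBoundary_of_adj_not_mem (hE : E.IsZdAdmissible) (hEΩ : E.Ω = Set.Ioo x₀ x₁ ×ℂ Set.Ioo y₀ y₁)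
    {x y : Site 2} (hx : x ∈ meshVertices E.Ω E.δ) (hxy : (zdGraph 2).Adj x y)
    (hy : y ∉ meshVertices E.Ω E.δ) : x ∈ E.zdBoundary :=
  E.meshBoundary_subset_zdBoundary (mem_meshBoundary_of_adj_not_mem
    (by rw [meshDomain_eq_rect hE hEΩ]; exact hx) hxy (by rw [meshDomain_eq_rect hE hEΩ]; exact hy))

/-- **The four sides.** A discrete boundary site of the rectangle lies on the bottom or top row
(`δ (x₁ - 1) ≤ y₀` or `y₁ ≤ δ (x₁ + 1)`, coordinate `1`) or on the left or right column
(coordinate `0`) of the box. -/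
theorem side_of_mem_zdBoundary (hE : E.IsZdAdmissible) (hEΩ : E.Ω = Set.Ioo x₀ x₁ ×ℂ Set.Ioo y₀ y₁)
    {x : Site 2} (hx : x ∈ E.zdBoundary) :
    (E.δ * (x 1 - 1) ≤ y₀ ∨ y₁ ≤ E.δ * (x 1 + 1)) ∨ (E.δ * (x 0 - 1) ≤ x₀ ∨ x₁ ≤ E.δ * (x 0 + 1)) := by
  have hδ := hE.delta_pos
  obtain ⟨hxV, y, hxy, hyV⟩ := exists_adj_not_mem_of_mem_zdBoundary hE hEΩ hx
  rw [mem_meshVertices_rect' hEΩ] at hxV hyV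
  rw [zdGraph_adj_iff] at hxy
  obtain ⟨i, hi⟩ := hxy
  have hcoord : ∀ k, (y k = x k + Pi.single (M := fun _ : Fin 2 => ℤ) i 1 k) ∨ (x k = y k + Pi.single (M := fun _ : Fin 2 => ℤ) i 1 k) := by
    intro k
    rcases hi with h | h
    · exact Or.inl (by rw [h]; rfl)
    · exact Or.inr (by rw [h]; rfl)
  fin_cases i
  · -- horizontal neighbour: `y 1 = x 1`, `y 0 = x 0 ± 1`
    have h1 : y 1 = x 1 := by
      rcases hcoord 1 with h | h
      · simpa using h
      · simpa [eq_comm] using h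
    have h0 : y 0 = x 0 + 1 ∨ y 0 = x 0 - 1 := by
      rcases hcoord 0 with h | h
      · left; simpa using h
      · right; simp at h; omega
    right
    rw [h1] at hyV
    rcases h0 with e | e <;> rw [e] at hyV <;> push_cast at hyV
    · right
      by_contra hcon
      rw [not_le] at hcon
      exact hyV ⟨⟨by linarith [hxV.1.1], hcon⟩, hxV.2⟩
    · left
      by_contra hcon
      rw [not_le] at hcon
      exact hyV ⟨⟨hcon, by linarith [hxV.1.2]⟩, hxV.2⟩
  · -- vertical neighbour: `y 0 = x 0`, `y 1 = x 1 ± 1`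
    have h0 : y 0 = x 0 := by
      rcases hcoord 0 with h | h
      · simpa using h
      · simpa [eq_comm] using h
    have h1 : y 1 = x 1 + 1 ∨ y 1 = x 1 - 1 := by
      rcases hcoord 1 with h | h
      · left; simpa using h
      · right; simp at h; omega
    left
    rw [h0] at hyV
    rcases h1 with e | e <;> rw [e] at hyV <;> push_cast at hyV
    · right
      by_contra hcon
      rw [not_le] at hcon
      exact hyV ⟨hxV.1, by linarith [hxV.2.1], hcon⟩
    · left
      by_contra hcon
      rw [not_le] at hcon
      exact hyV ⟨hxV.1, hcon, by linarith [hxV.2.2]⟩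

/-- Box sites on one of the four sides are discrete boundary sites. -/
theorem mem_zdBoundary_of_side (hE : E.IsZdAdmissible) (hEΩ : E.Ω = Set.Ioo x₀ x₁ ×ℂ Set.Ioo y₀ y₁)
    {x : Site 2} (hxV : x ∈ meshVertices E.Ω E.δ)
    (hside : (E.δ * (x 1 - 1) ≤ y₀ ∨ y₁ ≤ E.δ * (x 1 + 1)) ∨ (E.δ * (x 0 - 1) ≤ x₀ ∨ x₁ ≤ E.δ * (x 0 + 1))) :
    x ∈ E.zdBoundary := by
  rcases hside with (h | h) | (h | h)
  · refine mem_zdBoundary_of_adj_not_mem hE hEΩ hxV (adj_update_sub_one x 1) fun hy => ?_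
    have h' := ((mem_meshVertices_rect' hEΩ).1 hy).2.1
    simp only [Function.update_self] at h'; push_cast at h'; linarith
  · refine mem_zdBoundary_of_adj_not_mem hE hEΩ hxV (adj_update_add_one x 1) fun hy => ?_
    have h' := ((mem_meshVertices_rect' hEΩ).1 hy).2.2
    simp only [Function.update_self] at h'; push_cast at h'; linarith
  · refine mem_zdBoundary_of_adj_not_mem hE hEΩ hxV (adj_update_sub_one x 0) fun hy => ?_
    have h' := ((mem_meshVertices_rect' hEΩ).1 hy).1.1
    simp only [Function.update_self] at h'; push_cast at h'; linarith
  · refine mem_zdBoundary_of_adj_not_mem hE hEΩ hxV (adj_update_add_one x 0) fun hy => ?_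
    have h' := ((mem_meshVertices_rect' hEΩ).1 hy).1.2
    simp only [Function.update_self] at h'; push_cast at h'; linarith

end Boundary

/-! ## The registered anchor -/

/-- **The four sides, closed form** (registered anchor `ufrs_rect_sideOfZdBoundary` of
stmt-CriticalPhenomena-11387): a discrete boundary site of `ℤ²`-admissible data of the open
rectangle `(x₀, x₁) × (y₀, y₁)` lies on the bottom or top row or on the left or right column of the
lattice box (`side_of_mem_zdBoundary` with all binders explicit). -/
theorem ufrs_rect_sideOfZdBoundary : ∀ (E : DiscreteDobrushin) (x₀ x₁ y₀ y₁ : ℝ), E.IsZdAdmissible → E.Ω = Set.Ioo x₀ x₁ ×ℂ Set.Ioo y₀ y₁ → ∀ x ∈ E.zdBoundary, (E.δ * (x 1 - 1) ≤ y₀ ∨ y₁ ≤ E.δ * (x 1 + 1)) ∨ (E.δ * (x 0 - 1) ≤ x₀ ∨ x₁ ≤ E.δ * (x 0 + 1)) :=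
  fun E x₀ x₁ y₀ y₁ hE hEΩ x hx => side_of_mem_zdBoundary hE hEΩ hx

end

end Summit.CriticalPhenomena.CardyFormulaZ2.Cruxes.EdgePrecompact.QkzStripBoundaryArm
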